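import Literature.AlgebraicGeometry.Hironaka2017.Lib.Multinomial
import Literature.AlgebraicGeometry.Resolution.DifferentialOperators
import Mathlib.RingTheory.Smooth.Basic
import Mathlib.RingTheory.MvPolynomial.Ideal
import HarnessLib

/-!
# Truncated Hasse–Schmidt Taylor lifts along formally smooth coordinates

Topic: `Literature/AlgebraicGeometry/Resolution`. Let `K` be a commutative ring, `O` a commutative `K`-algebra and
`x₁, …, xₙ ∈ O`. A **Taylor lift of order `N`** for `x` is a `K`-algebra map `τ : O → O[Y₁,…,Yₙ]/(Y)^{N+1}` with
`τ(b)|_{Y=0} = b` and `τ(xᵢ) = xᵢ + Yᵢ` — a truncated Hasse–Schmidt homomorphism «`x ↦ x + Y`». Its coefficient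
operators `D^{[β]} = coeff_{Y^β} ∘ τ`, `|β| ≤ N`, are `K`-linear, satisfy the Leibniz rule, `D^{[0]} = id`,
`D^{[β]}(x^α) = (α over β) x^{α−β}`, and are differential operators of order `≤ |β|` in Grothendieck's sense (the tree's
`IsDiffOpLE`; EGA IV₄ 16.11.2 for the polynomial ring). Everything is PROVED and stated WITHOUT new definitions (the
lift `τ` and the operators `D` are existentially produced and then used through their characteristic properties
`(hev)`, `(hco)`, `(hD)` below):

* `exists_taylorLift` — **existence**: if `O` is formally smooth over `K[X₁,…,Xₙ]` for `Xᵢ ↦ xᵢ`, Taylor lifts of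
  every order exist (Mathlib `Algebra.FormallySmooth.liftOfSurjective` through the nilpotent thickening
  `O[Y]/(Y)^{N+1} → O`, `Y ↦ 0`, made a `K[X]`-algebra through `Xᵢ ↦ xᵢ + Yᵢ`);
* `exists_coeffOps` — the coefficient operators `D^{[β]}`, `|β| ≤ N`, as `K`-linear maps;
* `coeffOp_mul` (Leibniz), `coeffOp_zero_apply` (`D^{[0]} = id`), `commMul_coeffOp`, **`isDiffOpLE_coeffOp`**
  (`D^{[β]}` has order `≤ |β|`), `coeffOp_apply_mem_pow_sub` (`D^{[β]}(I^m) ⊆ I^{m−|β|}`), `coeffOp_powOf`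
  (values on monomials in the coordinates).

The order criterion built on this (`g ∈ 𝔪^m ∖ 𝔪^{m+1} ⇒ Diff^{≤ em}((g^e)) = O` for local `O` with `𝔪 = (x)`) is
`TaylorLiftOrderCriterion.lean`. Consumer: the Hironaka-2017 adjudication cell (typed clause
`Hironaka2017.S05NegativePart.U27L24`, p.27 l.24); nothing about that manuscript is asserted here.

Sources: [EGAIV4] §16.8, Thm. 16.11.2; [Matsumura1987] §25–§28 (higher derivations, formal smoothness);
[StacksProject] Tag 02HH (formally smooth: lifting through nilpotent thickenings).
-/

noncomputable section

open MvPolynomial Finset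

namespace Literature.AlgebraicGeometry.Resolution

namespace TaylorLift

universe u v

variable (K : Type u) [CommRing K] (n : ℕ) (O : Type v) [CommRing O] [Algebra K O]

/-! ## Coefficients of degree `≤ N` on `O[Y₁,…,Yₙ]/(Y)^{N+1}` -/

variable {n O} in
/-- Coefficients of degree `≤ N` are well defined on `O[Y]/(Y)^{N+1}`.
[cite: EGAIV4, Déf. 16.3.1 (truncated algebras modulo a power of the augmentation ideal)] -/
theorem coeff_eq_of_mk_eq {N : ℕ} {p q : MvPolynomial (Fin n) O}
    (hpq : Ideal.Quotient.mk ((idealOfVars (Fin n) O) ^ (N + 1)) p = Ideal.Quotient.mk _ q)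
    {β : Fin n →₀ ℕ} (hβ : β.degree ≤ N) : coeff β p = coeff β q := by
  rw [Ideal.Quotient.eq, mem_pow_idealOfVars_iff'] at hpq
  have h := hpq β (by omega)
  rwa [coeff_sub, sub_eq_zero] at h

/-! ## Existence of Taylor lifts along formally smooth coordinates -/

/-- **Existence of Taylor lifts along formally smooth coordinates.** If `O` is formally smooth over
`K[X₁,…,Xₙ]` for the structure map `Xᵢ ↦ xᵢ` (`MvPolynomial.aeval x`), then for every `N` there is a `K`-algebra
map `τ : O → O[Y]/(Y)^{N+1}` with `τ(b)|_{Y=0} = b` (first clause, on representatives) and `τ(xᵢ) = xᵢ + Yᵢ`: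
lift the identity of `O` through the nilpotent thickening `O[Y]/(Y)^{N+1} → O`, `Y ↦ 0`, viewed as a
`K[X]`-algebra through `Xᵢ ↦ xᵢ + Yᵢ` (Mathlib `Algebra.FormallySmooth.liftOfSurjective`).
[cite: StacksProject, Tag 02HH (formal smoothness: lifting through nilpotent thickenings)] -/
theorem exists_taylorLift (x : Fin n → O)
    (hO : letI := (MvPolynomial.aeval x : MvPolynomial (Fin n) K →ₐ[K] O).toRingHom.toAlgebra
      Algebra.FormallySmooth (MvPolynomial (Fin n) K) O) (N : ℕ) :
    ∃ τ : O →ₐ[K] (MvPolynomial (Fin n) O ⧸ (idealOfVars (Fin n) O) ^ (N + 1)),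
      (∀ (b : O) (p : MvPolynomial (Fin n) O), Ideal.Quotient.mk _ p = τ b →
        MvPolynomial.aeval (fun _ : Fin n => (0 : O)) p = b) ∧
      (∀ i : Fin n, τ (x i) = Ideal.Quotient.mk _ (C (x i) + X i)) := by
  set R := MvPolynomial (Fin n) K with hR
  set T := MvPolynomial (Fin n) O ⧸ (idealOfVars (Fin n) O) ^ (N + 1) with hT
  -- the twisted `K[X]`-structure `Xᵢ ↦ xᵢ + Yᵢ` on the target (the only `K[X]`-structure on `T` in scope)
  let φ : R →ₐ[K] T := (Ideal.Quotient.mkₐ K _).comp (MvPolynomial.aeval fun i => C (x i) + X i)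
  letI algRT : Algebra R T := φ.toRingHom.toAlgebra
  have halgT : ∀ p, algebraMap R T p = φ p := fun _ => rfl
  haveI towT : IsScalarTower K R T :=
    IsScalarTower.of_algebraMap_eq (R := K) (S := R) (A := T) fun c => by rw [halgT, AlgHom.commutes]
  -- evaluation at `Y = 0` on `T`
  have hker : ∀ q ∈ (idealOfVars (Fin n) O) ^ (N + 1),
      MvPolynomial.aeval (fun _ : Fin n => (0 : O)) q = 0 := by
    intro q hq
    have hq1 : q ∈ idealOfVars (Fin n) O := Ideal.pow_le_self (Nat.succ_ne_zero N) hq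
    have hle : idealOfVars (Fin n) O ≤
        RingHom.ker (MvPolynomial.aeval (fun _ : Fin n => (0 : O))).toRingHom := by
      rw [idealOfVars, Ideal.span_le]
      rintro _ ⟨i, rfl⟩
      simp
    exact hle hq1
  let ev : T →ₐ[O] O := Ideal.Quotient.liftₐ _ (MvPolynomial.aeval fun _ : Fin n => (0 : O)) hker
  have hev : ∀ q, ev (Ideal.Quotient.mk _ q) = MvPolynomial.aeval (fun _ : Fin n => (0 : O)) q :=
    fun _ => rfl
  -- the coordinate structure `Xᵢ ↦ xᵢ` on `O`, kept OUT of instance resolution (it would also induce the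
  -- coefficient-wise `K[X]`-action on `T`, different from the twisted one)
  let algRO : Algebra R O := (MvPolynomial.aeval x : R →ₐ[K] O).toRingHom.toAlgebra
  have hO' : @Algebra.FormallySmooth R O _ _ algRO := hO
  let g : @AlgHom R T O _ _ _ algRT algRO :=
    @AlgHom.mk R T O _ _ _ algRT algRO ev.toRingHom fun p => by
      change ev (φ p) = (MvPolynomial.aeval x p : O)
      change ((ev.restrictScalars K).comp φ) p = MvPolynomial.aeval x p
      congr 1
      refine MvPolynomial.algHom_ext fun i => ?_
      simp [φ, hev]
  have hg_apply : ∀ q, g q = ev q := fun _ => rfl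
  have hg : Function.Surjective g := fun b =>
    ⟨Ideal.Quotient.mk _ (C (b : O)), by rw [hg_apply, hev]; simp⟩
  have hg' : IsNilpotent (RingHom.ker (g : T →+* O)) := by
    have hle : RingHom.ker (g : T →+* O) ≤
        (idealOfVars (Fin n) O).map (Ideal.Quotient.mk ((idealOfVars (Fin n) O) ^ (N + 1))) := by
      intro q hq
      obtain ⟨q, rfl⟩ := Ideal.Quotient.mk_surjective q
      rw [RingHom.mem_ker] at hq
      change ev (Ideal.Quotient.mk _ q) = 0 at hq
      rw [hev] at hq
      refine Ideal.mem_map_of_mem _ ?_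
      rw [← pow_one (idealOfVars (Fin n) O), mem_pow_idealOfVars_iff']
      intro β hβ
      have hβ0 : β = 0 := by rw [← Finsupp.degree_eq_zero_iff]; omega
      subst hβ0
      simpa [MvPolynomial.aeval_zero, constantCoeff] using hq
    refine ⟨N + 1, ?_⟩
    rw [Submodule.zero_eq_bot, ← le_bot_iff]
    calc RingHom.ker (g : T →+* O) ^ (N + 1)
        ≤ ((idealOfVars (Fin n) O).map (Ideal.Quotient.mk ((idealOfVars (Fin n) O) ^ (N + 1)))) ^ (N + 1) :=
          Ideal.pow_right_mono hle _
      _ = ⊥ := by rw [← Ideal.map_pow, Ideal.map_quotient_self]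
  -- the lift
  let τR : @AlgHom R O T _ _ _ algRO algRT :=
    @Algebra.FormallySmooth.liftOfSurjective R O _ _ algRO T _ algRT O _ algRO hO'
      (@AlgHom.id R O _ _ algRO) g hg hg'
  have hτR : ∀ b, g (τR b) = b := fun b =>
    @Algebra.FormallySmooth.liftOfSurjective_apply R O _ _ algRO T _ algRT O _ algRO hO'
      (@AlgHom.id R O _ _ algRO) g hg hg' b
  have hτRc : ∀ p : R, τR (MvPolynomial.aeval x p) = φ p := fun p =>
    @AlgHom.commutes R O T _ _ _ algRO algRT τR p
  let τ : O →ₐ[K] T :=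
    { toFun := fun b => τR b
      map_one' := map_one τR
      map_mul' := fun a b => map_mul τR a b
      map_zero' := map_zero τR
      map_add' := fun a b => map_add τR a b
      commutes' := fun c => by
        have h1 : algebraMap K O c = MvPolynomial.aeval x (algebraMap K R c) := by
          rw [AlgHom.commutes]
        change τR (algebraMap K O c) = algebraMap K T c
        rw [h1, hτRc, AlgHom.commutes] }
  refine ⟨τ, fun b p hp => ?_, fun i => ?_⟩
  · have h1 := hτR b
    change ev (τR b) = b at h1
    change Ideal.Quotient.mk _ p = τR b at hp
    rw [← hp, hev] at h1
    exact h1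
  · have h1 : x i = MvPolynomial.aeval x (X i : R) := by rw [MvPolynomial.aeval_X]
    have h2 : τR (x i) = φ (X i) := by rw [h1]; exact hτRc (X i)
    change τR (x i) = _
    rw [h2]
    change (Ideal.Quotient.mkₐ K _) (MvPolynomial.aeval _ (X i)) = _
    rw [MvPolynomial.aeval_X]
    rfl

/-! ## The coefficient operators `D^{[β]} = coeff_{Y^β} ∘ τ`, `|β| ≤ N` -/

variable {n O}

/-- **The coefficient operators of a `K`-algebra map `τ : O → O[Y]/(Y)^{N+1}` exist as `K`-linear maps**: there is a
family `D` with `D β b = coeff_{Y^β}(p)` for every representative `p` of `τ(b)` and every `|β| ≤ N` (the values of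
`D β` for `|β| > N` are irrelevant). [cite: Matsumura1987, §27 (higher derivations: the components D_i of x ↦ Σ D_i(x) t^i)] -/
theorem exists_coeffOps {N : ℕ} (τ : O →ₐ[K] (MvPolynomial (Fin n) O ⧸ (idealOfVars (Fin n) O) ^ (N + 1))) :
    ∃ D : (Fin n →₀ ℕ) → (O →ₗ[K] O), ∀ β : Fin n →₀ ℕ, β.degree ≤ N →
      ∀ (b : O) (p : MvPolynomial (Fin n) O), Ideal.Quotient.mk _ p = τ b → D β b = coeff β p := by
  classical
  -- a representative of `τ b`
  let rep : O → MvPolynomial (Fin n) O := fun b => (Ideal.Quotient.mk_surjective (τ b)).choose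
  have hrep : ∀ b, Ideal.Quotient.mk ((idealOfVars (Fin n) O) ^ (N + 1)) (rep b) = τ b :=
    fun b => (Ideal.Quotient.mk_surjective (τ b)).choose_spec
  have hwd : ∀ {β : Fin n →₀ ℕ}, β.degree ≤ N → ∀ (b : O) (p : MvPolynomial (Fin n) O),
      Ideal.Quotient.mk _ p = τ b → coeff β (rep b) = coeff β p :=
    fun hβ b p hp => coeff_eq_of_mk_eq (by rw [hrep, hp]) hβ
  refine ⟨fun β => if hβ : β.degree ≤ N then
    { toFun := fun b => coeff β (rep b)
      map_add' := fun a b => by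
        rw [hwd hβ (a + b) (rep a + rep b) (by rw [map_add, hrep, hrep, map_add]), coeff_add]
      map_smul' := fun c b => by
        have h : Ideal.Quotient.mk ((idealOfVars (Fin n) O) ^ (N + 1)) (c • rep b) = τ (c • b) := by
          rw [map_smul τ, ← hrep b]
          exact map_smul (Ideal.Quotient.mkₐ K ((idealOfVars (Fin n) O) ^ (N + 1))) c (rep b)
        rw [hwd hβ (c • b) (c • rep b) h, coeff_smul, RingHom.id_apply] } else 0,
    fun β hβ b p hp => ?_⟩
  simp only [dif_pos hβ, LinearMap.coe_mk, AddHom.coe_mk]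
  exact hwd hβ b p hp

section Ops

variable {K}
variable {N : ℕ} {x : Fin n → O} {τ : O →ₐ[K] (MvPolynomial (Fin n) O ⧸ (idealOfVars (Fin n) O) ^ (N + 1))}
  {D : (Fin n →₀ ℕ) → (O →ₗ[K] O)}

/-- **Leibniz rule** `D^{[β]}(ab) = Σ_{γ+δ=β} D^{[γ]}(a) D^{[δ]}(b)`, `|β| ≤ N`.
[cite: Matsumura1987, §27 (higher derivations, Leibniz identities)] -/
theorem coeffOp_mul
    (hD : ∀ β : Fin n →₀ ℕ, β.degree ≤ N → ∀ (b : O) (p : MvPolynomial (Fin n) O),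
      Ideal.Quotient.mk _ p = τ b → D β b = coeff β p)
    {β : Fin n →₀ ℕ} (hβ : β.degree ≤ N) (a b : O) :
    D β (a * b) = ∑ q ∈ Finset.antidiagonal β, D q.1 a * D q.2 b := by
  obtain ⟨pa, hpa⟩ := Ideal.Quotient.mk_surjective (τ a)
  obtain ⟨pb, hpb⟩ := Ideal.Quotient.mk_surjective (τ b)
  rw [hD β hβ (a * b) (pa * pb) (by rw [map_mul, hpa, hpb, map_mul]), coeff_mul]
  refine Finset.sum_congr rfl fun q hq => ?_
  have hq' : q.1 + q.2 = β := Finset.mem_antidiagonal.mp hq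
  have hdeg : q.1.degree + q.2.degree = β.degree := by rw [← map_add, hq']
  rw [hD q.1 (by omega) a pa hpa, hD q.2 (by omega) b pb hpb]

/-- `D^{[0]} = id` for a Taylor lift (`τ(b)|_{Y=0} = b`). [cite: Matsumura1987, §27 (D_0 = id)] -/
theorem coeffOp_zero_apply
    (hev : ∀ (b : O) (p : MvPolynomial (Fin n) O), Ideal.Quotient.mk _ p = τ b →
      MvPolynomial.aeval (fun _ : Fin n => (0 : O)) p = b)
    (hD : ∀ β : Fin n →₀ ℕ, β.degree ≤ N → ∀ (b : O) (p : MvPolynomial (Fin n) O),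
      Ideal.Quotient.mk _ p = τ b → D β b = coeff β p) (b : O) :
    D 0 b = b := by
  obtain ⟨p, hp⟩ := Ideal.Quotient.mk_surjective (τ b)
  rw [hD 0 (by simp) b p hp]
  simpa [MvPolynomial.aeval_zero, constantCoeff] using hev b p hp

/-- **The commutator of `D^{[β]}` with a multiplication** is a combination of lower coefficient operators:
`[D^{[β]}, a] = Σ_{γ+δ=β, γ ≠ 0} D^{[γ]}(a) • D^{[δ]}`, `|β| ≤ N`. [cite: EGAIV4, Prop. 16.8.8 (b)] -/
theorem commMul_coeffOp
    (hev : ∀ (b : O) (p : MvPolynomial (Fin n) O), Ideal.Quotient.mk _ p = τ b →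
      MvPolynomial.aeval (fun _ : Fin n => (0 : O)) p = b)
    (hD : ∀ β : Fin n →₀ ℕ, β.degree ≤ N → ∀ (b : O) (p : MvPolynomial (Fin n) O),
      Ideal.Quotient.mk _ p = τ b → D β b = coeff β p)
    {β : Fin n →₀ ℕ} (hβ : β.degree ≤ N) (a : O) :
    commMul K (D β) a = ∑ q ∈ (Finset.antidiagonal β).erase (0, β), D q.1 a • D q.2 := by
  refine LinearMap.ext fun t => ?_
  have h0 : ((0 : Fin n →₀ ℕ), β) ∈ Finset.antidiagonal β := by simp
  rw [commMul_apply, coeffOp_mul hD hβ, ← Finset.add_sum_erase _ _ h0, LinearMap.sum_apply]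
  simp only [coeffOp_zero_apply hev hD, LinearMap.smul_apply, smul_eq_mul]
  ring

/-- **The coefficient operators of a Taylor lift are differential operators of order `≤ |β|`** (relative to `K`,
`|β| ≤ N`), in every characteristic: by induction on `|β|`, the commutator `[D^{[β]}, a]` is a combination of
coefficient operators of strictly smaller degree.
[cite: EGAIV4, Thm. 16.11.2 (the D_p are differential operators of order ≤ |p|)] -/
theorem isDiffOpLE_coeffOp
    (hev : ∀ (b : O) (p : MvPolynomial (Fin n) O), Ideal.Quotient.mk _ p = τ b →
      MvPolynomial.aeval (fun _ : Fin n => (0 : O)) p = b)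
    (hD : ∀ β : Fin n →₀ ℕ, β.degree ≤ N → ∀ (b : O) (p : MvPolynomial (Fin n) O),
      Ideal.Quotient.mk _ p = τ b → D β b = coeff β p) :
    ∀ (d : ℕ) (β : Fin n →₀ ℕ), β.degree ≤ d → d ≤ N → IsDiffOpLE K d (D β)
  | 0, β, hβ, _ => by
    have hβ0 : β = 0 := by
      rw [← Finsupp.degree_eq_zero_iff]; omega
    subst hβ0
    intro a
    refine LinearMap.ext fun t => ?_
    simp only [commMul_apply, coeffOp_zero_apply hev hD, LinearMap.zero_apply]
    ring
  | d + 1, β, hβ, hdN => fun a => by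
    rw [commMul_coeffOp hev hD (hβ.trans hdN)]
    refine IsDiffOpLE.sum _ fun q hq =>
      IsDiffOpLE.smul _ (isDiffOpLE_coeffOp hev hD d q.2 ?_ (by omega))
    obtain ⟨hne, hq'⟩ := Finset.mem_erase.mp hq
    rw [Finset.mem_antidiagonal] at hq'
    have h1 : q.1 ≠ 0 := by
      intro h1
      apply hne
      rw [h1, zero_add] at hq'
      exact Prod.ext h1 hq'
    have hdeg : q.1.degree + q.2.degree = β.degree := by rw [← map_add, hq']
    have h1' : 1 ≤ q.1.degree := by
      rw [Nat.one_le_iff_ne_zero, Ne, Finsupp.degree_eq_zero_iff]; exact h1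
    omega

/-- `D^{[β]}` lowers the `I`-adic order by at most `|β|` (`|β| ≤ N`). [cite: VillamayorU2008ReesDiff, §4.1] -/
theorem coeffOp_apply_mem_pow_sub
    (hev : ∀ (b : O) (p : MvPolynomial (Fin n) O), Ideal.Quotient.mk _ p = τ b →
      MvPolynomial.aeval (fun _ : Fin n => (0 : O)) p = b)
    (hD : ∀ β : Fin n →₀ ℕ, β.degree ≤ N → ∀ (b : O) (p : MvPolynomial (Fin n) O),
      Ideal.Quotient.mk _ p = τ b → D β b = coeff β p)
    (I : Ideal O) {m : ℕ} {β : Fin n →₀ ℕ} (hβ : β.degree ≤ N) {b : O} (hb : b ∈ I ^ m) :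
    D β b ∈ I ^ (m - β.degree) :=
  IsDiffOpLE.apply_mem_pow_sub I m (isDiffOpLE_coeffOp hev hD β.degree β le_rfl hβ) hb

/-- **Values on monomials in the coordinates**: `D^{[γ]}(x^α) = (α over γ) x^{α−γ}` (and `0` unless `γ ≤ α`),
`|γ| ≤ N` — the coefficients of `∏ (xᵢ + Yᵢ)^{αᵢ}`, for a lift with `τ(xᵢ) = xᵢ + Yᵢ`.
[cite: EGAIV4, Thm. 16.11.2 (values of the D_p on monomials)] -/
theorem coeffOp_powOf
    (hco : ∀ i : Fin n, τ (x i) = Ideal.Quotient.mk _ (C (x i) + X i))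
    (hD : ∀ β : Fin n →₀ ℕ, β.degree ≤ N → ∀ (b : O) (p : MvPolynomial (Fin n) O),
      Ideal.Quotient.mk _ p = τ b → D β b = coeff β p)
    {γ : Fin n →₀ ℕ} (hγ : γ.degree ≤ N) (α : Fin n →₀ ℕ) :
    D γ (Hironaka2017.S03DiffARNE.powOf x α) = Hironaka2017.S03DiffARNE.eq8Rhs x γ α := by
  have hτ : Ideal.Quotient.mk ((idealOfVars (Fin n) O) ^ (N + 1)) (∏ i, (C (x i) + X i) ^ α i) =
      τ (Hironaka2017.S03DiffARNE.powOf x α) := by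
    rw [Hironaka2017.S03DiffARNE.powOf, map_prod, map_prod]
    refine Finset.prod_congr rfl fun i _ => ?_
    rw [map_pow, map_pow, hco i]
  rw [hD γ hγ _ _ hτ, Hironaka2017.S03DiffARNE.coeff_prod_C_add_X_pow]

end Ops

end TaylorLift

end Literature.AlgebraicGeometry.Resolution

end
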